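import Mathlib
import HarnessLib
import Literature.Analysis.FluidPDE.HelicityDensityPseudoscalar
import Summits.NavierStokesRegularity.NavierStokesRegularity.Theorems.UnthreadedDoorAntidynamoSingleDegreeRungOdd
import Summits.NavierStokesRegularity.NavierStokesRegularity.Theorems.UnthreadedDoorAntidynamoWallTwinDichotomy

/-!
# Route `UnthreadedDoor` / `ThreadingFlux`, crux `PoloidalLiouville` (stmt-NavierStokesRegularity-1222), antidynamo v2 skeleton
# (sha16 `4ebf5683127b`), WALL `stub_scalarLiouville`: ANTI-TWINS (u = −v) — the ANTI-SYMMETRIC sectors with a reversed centre velocity are trivial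
# (the odd sector p799093 is the case `R = −1`)

Support file (seat leafhand-ns-unthreadeddoor-2 g1, cell decomp-ns), `--supports stmt-NavierStokesRegularity-1222 --as helper`; theorems only.

A **negative twin** of the wall's flow `v` is a member `u` of the class with `u = −v`; equivalently (`negTwin_of_curl_neg`) a member with the
OPPOSITE vorticity at every time and the opposite centre velocity.  For every linear isometry `R` fixing the centre, the conjugate
`u = R v(x₀ + R⁻¹(· − x₀))` is in the class (`CellFlux.isBoundedAncientMildSolution_frame`); it is a negative twin exactly on the ANTI-SYMMETRIC
sector `curl v(t)(x₀ + R y) = −det R • R (curl v(t)(x₀ + y))` with REVERSED centre velocity `R v(t, x₀) = −v(t, x₀)`.  The parity-splitting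
argument of the odd rung (p798877: `v` and `−v` both solve the vorticity formulation ⇒ the vorticity is CALORIC, `∂ₜω = Δω`; a bounded ancient
caloric field is constant — `Literature.Analysis.PDE.heat_liouville` —, and a constant field tangent to the spheres about `x₀` vanishes) then closes
the sector:

* `negTwin_of_curl_neg` — opposite vorticity + opposite centre velocity ⇒ `u = −v` (curl- and divergence-free bounded fields are constant).
* `timeDerivWithin_vorticity_eq_laplacian_of_negTwin` — `v`, `−v` both classical vorticity solutions ⇒ `∂ₜω = Δω` (and the transport and
  stretching terms balance separately).
* `curl_eq_zero_of_caloric_unthreaded` — bounded caloric vorticity tangent to the spheres about `x₀` ⇒ `ω ≡ 0`.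
* ★★ `curl_eq_zero_of_curl_antisymmetric_of_centre_reversed` — class + unthreaded about `x₀` + `R`-ANTI-symmetric vorticity + `R v(t,x₀) = −v(t,x₀)`
  at every `t < 0` ⇒ `curl v ≡ 0` on `(−∞,0) × ℝ³`; instances: `R = −1` (odd potentials: the centre condition is automatic — p799093 recovered),
  a mirror `σ` with VECTOR-even vorticity `ω(x₀ + σy) = σ ω(x₀ + y)` and centre velocity normal to the mirror, the rotation by `π` about an axis `n`
  with `ω(x₀ + R y) = −R ω(x₀ + y)` and centre velocity orthogonal to `n`; `constant_…`.

MEANING FOR THE WALL (repair census): with p816327 (`R`-SYMMETRIC ⇒ irrotational ∨ exactly `R`-equivariant) both parities of every isometry `R`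
fixing `x₀` are now tabulated; what remains of the anti-symmetric sector is the case `R v(t₁,x₀) ≠ −v(t₁,x₀)` at some instant, where the vorticity
obeys the DRIFT-heat equation `∂ₜω = Δω − ½((v + u)(t,x₀)·∇)ω` and a Galilean change of frame (not in the tree for this class) would finish.
HONEST LABEL: nothing here proves `stub_scalarLiouville`, `PoloidalLiouville` (1222), or bears on Navier–Stokes regularity; no summit statement is
proved (crux 1222 is INCOMPARABLE with the summit). [folklore]
[cite: KochNadirashviliSereginSverak2009, Thm 5.2 (arXiv:0709.3599 pp. 9–10)]
-/

noncomputable section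

-- the summit and its single sub-problem share the name (CONVENTIONS §1)
set_option linter.dupNamespace false

open scoped Topology InnerProductSpace RealInnerProductSpace ContDiff Laplacian
open Filter Set Function Metric MeasureTheory
open Literature.Analysis.FluidPDE

namespace Summit.NavierStokesRegularity.NavierStokesRegularity.Theorems.PoloidalLiouville.Antidynamo

open Summit.NavierStokesRegularity.NavierStokesRegularity.Theorems.PoloidalLiouville
  (constantOfIrrotational vorticityOfClass exists_norm_curl_le)
open Summit.NavierStokesRegularity.FluidComputer.AngularLadder (det_symm_eq_det)

/-! ### Negative twins -/

/-- **OPPOSITE VORTICITY AND OPPOSITE CENTRE VELOCITY ⇒ `u = −v`.**  Two bounded ancient mild solutions (duality class), jointly smooth on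
`(−∞,0) × ℝ³`, with `curl u(s) = −curl v(s)` and `u(s, x₀) = −v(s, x₀)` for every `s < 0`, satisfy `u = −v` on the slab (the sum is a bounded curl-
and divergence-free `C²` field, hence constant, and vanishes at `x₀`). [folklore] -/
theorem negTwin_of_curl_neg
    {v u : ℝ → EuclideanSpace ℝ (Fin 3) → EuclideanSpace ℝ (Fin 3)} (x₀ : EuclideanSpace ℝ (Fin 3))
    (hB : Literature.Analysis.FluidPDE.IsBoundedAncientMildSolution 1 v)
    (hsm : ContDiffOn ℝ (⊤ : ℕ∞) (Function.uncurry v) (Set.Iio 0 ×ˢ Set.univ))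
    (hBu : Literature.Analysis.FluidPDE.IsBoundedAncientMildSolution 1 u)
    (hsmu : ContDiffOn ℝ (⊤ : ℕ∞) (Function.uncurry u) (Set.Iio 0 ×ˢ Set.univ))
    (hcu : ∀ s < 0, ∀ x, curl (u s) x = -curl (v s) x) (hc : ∀ s < 0, u s x₀ = -v s x₀) :
    ∀ s < 0, ∀ y, u s y = -v s y := by
  have hsm' : IsSmoothSpaceTimeOn (Iio 0) v := hsm
  have hsmu' : IsSmoothSpaceTimeOn (Iio 0) u := hsmu
  obtain ⟨M, hM⟩ := hB.isBoundedOn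
  obtain ⟨Mu, hMu⟩ := hBu.isBoundedOn
  intro s hs y
  have hvs : ContDiff ℝ ∞ (v s) := hsm'.contDiff_slice hs
  have hus : ContDiff ℝ ∞ (u s) := hsmu'.contDiff_slice hs
  have hv2 : ContDiff ℝ 2 (v s) := hvs.of_le (by norm_cast)
  have hu2 : ContDiff ℝ 2 (u s) := hus.of_le (by norm_cast)
  set W : EuclideanSpace ℝ (Fin 3) → EuclideanSpace ℝ (Fin 3) := fun y => u s y + v s y with hW
  have hW2 : ContDiff ℝ 2 W := hu2.add hv2
  have hud : ∀ y, DifferentiableAt ℝ (u s) y := fun y => (hu2.differentiable (by norm_num)) y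
  have hvd : ∀ y, DifferentiableAt ℝ (v s) y := fun y => (hv2.differentiable (by norm_num)) y
  have hWcurl : ∀ y, curl W y = 0 := fun y => by
    rw [hW, curl_add (hud y) (hvd y), hcu s hs y, neg_add_cancel]
  have hdivv : VectorCalculus.IsDivFree (v s) :=
    (hB.isAncientMildSolution.1 s hs).isDivFree_of_contDiff (hvs.of_le (by norm_cast))
  have hdivu : VectorCalculus.IsDivFree (u s) :=
    (hBu.isAncientMildSolution.1 s hs).isDivFree_of_contDiff (hus.of_le (by norm_cast))
  have hWdiv : VectorCalculus.IsDivFree W := by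
    intro y
    have h1 := hdivu y
    have h2 := hdivv y
    simp only [VectorCalculus.divergence] at h1 h2 ⊢
    rw [hW, fderiv_fun_add (hud y) (hvd y), ContinuousLinearMap.toLinearMap_add, map_add, h1, h2, add_zero]
  have hWb : ∀ y, ‖W y‖ ≤ Mu + M := fun y => (norm_add_le _ _).trans (add_le_add (hMu s hs y) (hM s hs y))
  have hWy : W y = W x₀ := eq_of_curl_eq_zero_of_isDivFree_of_bounded hW2 hWcurl hWdiv hWb y x₀
  have hW0 : W x₀ = 0 := by rw [hW]; simp only; rw [hc s hs, neg_add_cancel]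
  have : u s y + v s y = 0 := by rw [← hW0, ← hWy]
  exact eq_neg_of_add_eq_zero_left this

/-- **`v` AND `−v` BOTH SOLVE THE VORTICITY FORMULATION ⇒ THE VORTICITY IS CALORIC.**  If `v` and a negative twin `u = −v` are both classical
solutions of the vorticity formulation on `(−∞,0)`, then `∂ₜω = Δω` pointwise (the transport and stretching terms are even under `v ↦ −v`, the
time derivative and the Laplacian of the vorticity are odd). [folklore] -/
theorem timeDerivWithin_vorticity_eq_laplacian_of_negTwin
    {v u : ℝ → EuclideanSpace ℝ (Fin 3) → EuclideanSpace ℝ (Fin 3)}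
    (hV : IsVorticitySolutionOn (Iio 0) 1 v) (hU : IsVorticitySolutionOn (Iio 0) 1 u)
    (hneg : ∀ s < 0, ∀ y, u s y = -v s y) {t : ℝ} (ht : t < 0) (x : EuclideanSpace ℝ (Fin 3)) :
    timeDerivWithin (Iio 0) (vorticity v) t x = (Δ (vorticity v t)) x := by
  have E1 := hV.vorticity_eq t ht x
  have E2 := hU.vorticity_eq t ht x
  have hfun : ∀ s < 0, u s = fun y => -v s y := fun s hs => funext (hneg s hs)
  have hcurl : ∀ s < 0, ∀ y, curl (u s) y = -curl (v s) y := fun s hs y => by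
    rw [hfun s hs]; exact curl_neg (v s) y
  -- (a) the time derivative of the vorticity of `u` is minus that of `v`
  have ha : timeDerivWithin (Iio 0) (vorticity u) t x = -timeDerivWithin (Iio 0) (vorticity v) t x := by
    rw [timeDerivWithin_apply, timeDerivWithin_apply]
    have hcongr : derivWithin (fun s => vorticity u s x) (Iio 0) t = derivWithin (-fun s => vorticity v s x) (Iio 0) t :=
      derivWithin_congr (fun s hs => by simp only [vorticity_apply, Pi.neg_apply]; exact hcurl s hs x)
        (by simp only [vorticity_apply, Pi.neg_apply]; exact hcurl t ht x)
    rw [hcongr, derivWithin.neg]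
  -- (b) slices: `ω_u = −ω_v`, `Du = −Dv`, `Dω_u = −Dω_v`
  have hωfun : vorticity u t = -vorticity v t := by
    funext y; rw [vorticity_apply, Pi.neg_apply, vorticity_apply]; exact hcurl t ht y
  have hb1 : fderiv ℝ (vorticity u t) x = -fderiv ℝ (vorticity v t) x := by rw [hωfun, fderiv_neg]
  have hb2 : fderiv ℝ (u t) x = -fderiv ℝ (v t) x := by
    rw [hfun t ht]
    exact fderiv_neg
  have hconv1 : convect (u t) (vorticity u t) x = convect (v t) (vorticity v t) x := by
    simp only [convect, hb1, hneg t ht x, _root_.neg_apply, map_neg, neg_neg]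
  have hconv2 : convect (vorticity u t) (u t) x = convect (vorticity v t) (v t) x := by
    simp only [convect, hb2, hωfun, Pi.neg_apply, _root_.neg_apply, map_neg, neg_neg]
  -- (c) the Laplacian
  have hc : (Δ (vorticity u t)) x = -(Δ (vorticity v t)) x := by
    rw [hωfun, InnerProductSpace.laplacian_neg, Pi.neg_apply]
  rw [ha, hconv1, hconv2, hc, one_smul] at E2
  rw [one_smul] at E1
  -- E1 : T + A = B + L ;  E2 : -T + A = B + -L
  have h2 : (2 : ℝ) • timeDerivWithin (Iio 0) (vorticity v) t x = (2 : ℝ) • (Δ (vorticity v t)) x := by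
    rw [two_smul, two_smul]
    have this : timeDerivWithin (Iio 0) (vorticity v) t x + convect (v t) (vorticity v t) x -
        (-timeDerivWithin (Iio 0) (vorticity v) t x + convect (v t) (vorticity v t) x) =
        convect (vorticity v t) (v t) x + (Δ (vorticity v t)) x -
        (convect (vorticity v t) (v t) x + -(Δ (vorticity v t)) x) := by rw [E1, E2]
    have e1 : timeDerivWithin (Iio 0) (vorticity v) t x + convect (v t) (vorticity v t) x -
        (-timeDerivWithin (Iio 0) (vorticity v) t x + convect (v t) (vorticity v t) x) =
        timeDerivWithin (Iio 0) (vorticity v) t x + timeDerivWithin (Iio 0) (vorticity v) t x := by abel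
    have e2 : convect (vorticity v t) (v t) x + (Δ (vorticity v t)) x -
        (convect (vorticity v t) (v t) x + -(Δ (vorticity v t)) x) = (Δ (vorticity v t)) x + (Δ (vorticity v t)) x := by abel
    rw [e1, e2] at this
    exact this
  exact smul_right_injective _ (two_ne_zero (α := ℝ)) h2

/-- **A BOUNDED CALORIC VORTICITY TANGENT TO THE SPHERES ABOUT A POINT VANISHES.**  If the vorticity of a classical solution of the vorticity
formulation on `(−∞,0)` is bounded, solves `∂ₜω = Δω` pointwise, and is tangent to the spheres about `x₀` at every time, then `ω ≡ 0`: by the heat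
Liouville theorem (`Literature.Analysis.PDE.heat_liouville`, Carleman frame as in p798877) `ω` is one constant vector `c₀` on the slab, and
`⟪c₀, c₀⟫ = ⟪(x₀ + c₀) − x₀, ω⟫ = 0`. [folklore] -/
theorem curl_eq_zero_of_caloric_unthreaded
    {v : ℝ → EuclideanSpace ℝ (Fin 3) → EuclideanSpace ℝ (Fin 3)} (hV : IsVorticitySolutionOn (Iio 0) 1 v)
    {K : ℝ} (hK : ∀ t < 0, ∀ x, ‖curl (v t) x‖ ≤ K) (x₀ : EuclideanSpace ℝ (Fin 3))
    (hun : ∀ t < 0, ∀ x, ⟪x - x₀, curl (v t) x⟫ = 0)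
    (hheat : ∀ t < 0, ∀ x, timeDerivWithin (Iio 0) (vorticity v) t x = (Δ (vorticity v t)) x) :
    ∀ t < 0, ∀ x, curl (v t) x = 0 := by
  have hsm : IsSmoothSpaceTimeOn (Iio 0) v := hV.smooth_velocity
  have hsmω : IsSmoothSpaceTimeOn (Iio 0) (vorticity v) := hsm.isSmoothSpaceTimeOn_vorticity isOpen_Iio.uniqueDiffOn
  have hO : IsOpen (Iio (0 : ℝ) ×ˢ (univ : Set (EuclideanSpace ℝ (Fin 3)))) := isOpen_Iio.prod isOpen_univ
  have hω2 : ContDiffOn ℝ 2 (uncurry (vorticity v)) (Iio (0 : ℝ) ×ˢ univ) := hsmω.of_le (by norm_cast)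
  -- the heat equation in the Carleman frame, on the whole open slab
  have hheat' : ∀ z ∈ Iio (0 : ℝ) ×ˢ (univ : Set (EuclideanSpace ℝ (Fin 3))),
      Carleman.dt (uncurry (vorticity v)) z = Carleman.lap (uncurry (vorticity v)) z := by
    rintro ⟨t, x⟩ hz
    have ht : t < 0 := (mem_prod.1 hz).1
    have hd : DifferentiableAt ℝ (uncurry (vorticity v)) (t, x) :=
      (hω2.differentiableOn (by norm_num)).differentiableAt (hO.mem_nhds hz)
    rw [Carleman.dt_uncurry hd, Carleman.lap_uncurry hO hz hω2, Literature.Analysis.FluidPDE.timeDeriv_apply,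
      ← derivWithin_of_isOpen isOpen_Iio ht, ← timeDerivWithin_apply]
    exact hheat t ht x
  -- constancy on the slab
  have key : ∀ t t' : ℝ, t < 0 → t' < 0 → ∀ x x' : EuclideanSpace ℝ (Fin 3), curl (v t) x = curl (v t') x' := by
    intro t t' ht ht' x x'
    have h := Literature.Analysis.PDE.heat_liouville (u := uncurry (vorticity v)) (T := 0) (A := K) (γ := 0) le_rfl
      zero_lt_one hω2 hheat' ?_ (z := (t, x)) (w := (t', x')) (mem_prod.2 ⟨ht, mem_univ _⟩)
      (mem_prod.2 ⟨ht', mem_univ _⟩)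
    · simpa [vorticity_apply] using h
    · rintro ⟨τ, y⟩ hz
      have hτ : τ < 0 := (mem_prod.1 hz).1
      rw [Real.rpow_zero, mul_one]
      show ‖vorticity v τ y‖ ≤ K
      rw [vorticity_apply]
      exact hK τ hτ y
  -- a constant field tangent to the spheres about `x₀` vanishes
  intro t ht x
  set c₀ := curl (v t) x with hc₀
  have h1 : curl (v t) (x₀ + c₀) = c₀ := key t t ht ht (x₀ + c₀) x
  have h2 : ⟪x₀ + c₀ - x₀, curl (v t) (x₀ + c₀)⟫ = 0 := hun t ht (x₀ + c₀)
  rw [h1, add_sub_cancel_left] at h2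
  exact inner_self_eq_zero.1 h2

/-! ### ★★ Anti-symmetric vorticity with a reversed centre velocity -/

/-- ★★ **ANTI-SYMMETRIC VORTICITY WITH A REVERSED CENTRE VELOCITY ⇒ IRROTATIONAL.**  Let `v` be a bounded ancient mild solution (`ν = 1`,
duality class) with measurable slices, jointly smooth on `(−∞,0) × ℝ³` and unthreaded about `x₀`; let `R` be a linear isometry.  If at every
`t < 0` the vorticity is ANTI-symmetric as a pseudovector about `x₀` under `R`, `curl v(t)(x₀ + R y) = −(det R • R (curl v(t)(x₀ + y)))`, and the
centre velocity is reversed by `R`, `R v(t, x₀) = −v(t, x₀)`, then `curl v ≡ 0` on `(−∞,0) × ℝ³`.  [The conjugate `R v(x₀ + R⁻¹(· − x₀))` is a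
negative twin; caloric vorticity; heat Liouville; tangency.]  `R = −1`: the odd sector (p799093).
[cite: KochNadirashviliSereginSverak2009, Thm 5.2 (arXiv:0709.3599 pp. 9–10)] -/
theorem curl_eq_zero_of_curl_antisymmetric_of_centre_reversed
    (v : ℝ → EuclideanSpace ℝ (Fin 3) → EuclideanSpace ℝ (Fin 3)) (x₀ : EuclideanSpace ℝ (Fin 3))
    (hB : Literature.Analysis.FluidPDE.IsBoundedAncientMildSolution 1 v)
    (hm : ∀ t < 0, AEStronglyMeasurable (v t) volume)
    (hsm : ContDiffOn ℝ (⊤ : ℕ∞) (Function.uncurry v) (Set.Iio 0 ×ˢ Set.univ))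
    (hun : ∀ t < 0, ∀ x, ⟪x - x₀, curl (v t) x⟫ = 0)
    (R : EuclideanSpace ℝ (Fin 3) ≃ₗᵢ[ℝ] EuclideanSpace ℝ (Fin 3))
    (hanti : ∀ t < 0, ∀ y, curl (v t) (x₀ + R y) =
      -((R : EuclideanSpace ℝ (Fin 3) →L[ℝ] EuclideanSpace ℝ (Fin 3)).det • R (curl (v t) (x₀ + y))))
    (hcen : ∀ t < 0, R (v t x₀) = -v t x₀) :
    ∀ t < 0, ∀ x, curl (v t) x = 0 := by
  have hsm' : IsSmoothSpaceTimeOn (Iio 0) v := hsm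
  -- the conjugated field `u(t, x) = R v(t, x₀ + R⁻¹ (x − x₀)) = R v(t, R⁻¹ x + c)`
  set c : EuclideanSpace ℝ (Fin 3) := x₀ - R.symm x₀ with hc
  set u : ℝ → EuclideanSpace ℝ (Fin 3) → EuclideanSpace ℝ (Fin 3) := fun s y => R (v s (R.symm y + c)) with hu
  have hBu : Literature.Analysis.FluidPDE.IsBoundedAncientMildSolution 1 u := by
    have h := CellFlux.isBoundedAncientMildSolution_frame hB R c (le_refl (0 : ℝ))
    have e : (fun s y => R (v (s + 0) (R.symm y + c))) = u := by
      funext s y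
      rw [add_zero]
    rw [e] at h
    exact h
  have hus : ∀ s < 0, ContDiff ℝ ∞ (u s) := fun s hs =>
    R.contDiff.comp ((hsm'.contDiff_slice hs).comp (R.symm.contDiff.add contDiff_const))
  have hmu : ∀ s < 0, AEStronglyMeasurable (u s) volume := fun s hs => (hus s hs).continuous.aestronglyMeasurable
  have hsmu : ContDiffOn ℝ (⊤ : ℕ∞) (Function.uncurry u) (Set.Iio 0 ×ˢ Set.univ) := by
    have hmap : ContDiff ℝ (⊤ : ℕ∞) fun p : ℝ × EuclideanSpace ℝ (Fin 3) => (p.1, R.symm p.2 + c) :=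
      contDiff_fst.prodMk ((R.symm.contDiff.comp contDiff_snd).add contDiff_const)
    have hmaps : MapsTo (fun p : ℝ × EuclideanSpace ℝ (Fin 3) => (p.1, R.symm p.2 + c)) (Iio 0 ×ˢ univ) (Iio 0 ×ˢ univ) :=
      fun p hp => ⟨hp.1, mem_univ _⟩
    exact R.contDiff.comp_contDiffOn (hsm.comp hmap.contDiffOn hmaps)
  -- the OPPOSITE vorticity
  have hcu : ∀ s < 0, ∀ x, curl (u s) x = -curl (v s) x := by
    intro s hs x
    rw [hu, curl_conj_rigidMotion R c (v s) x]
    have e1 : R.symm x + c = x₀ + R.symm (x - x₀) := by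
      rw [hc, map_sub]
      abel
    rw [e1]
    have h := hanti s hs (R.symm (x - x₀))
    rw [LinearIsometryEquiv.apply_symm_apply, add_sub_cancel] at h
    -- `h : curl (v s) x = -(det R • R (curl (v s) (x₀ + R⁻¹ (x − x₀))))`
    rw [h, neg_neg]
  -- the opposite centre velocity
  have hux0 : ∀ s < 0, u s x₀ = -v s x₀ := by
    intro s hs
    simp only [hu, hc, add_sub_cancel]
    exact hcen s hs
  -- negative twin ⇒ caloric vorticity ⇒ zero
  have hneg := negTwin_of_curl_neg x₀ hB hsm hBu hsmu hcu hux0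
  obtain ⟨hV, K, hK⟩ := vorticityOfClass v hB hm hsm
  obtain ⟨hU, -⟩ := vorticityOfClass u hBu hmu hsmu
  exact curl_eq_zero_of_caloric_unthreaded hV hK x₀ hun fun t ht x =>
    timeDerivWithin_vorticity_eq_laplacian_of_negTwin hV hU hneg ht x

/-- ★★ **… HENCE SLICE-WISE CONSTANT.** [cite: KochNadirashviliSereginSverak2009, Thm 5.2 (arXiv:0709.3599 pp. 9–10)] -/
theorem constant_of_curl_antisymmetric_of_centre_reversed
    (v : ℝ → EuclideanSpace ℝ (Fin 3) → EuclideanSpace ℝ (Fin 3)) (x₀ : EuclideanSpace ℝ (Fin 3))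
    (hB : Literature.Analysis.FluidPDE.IsBoundedAncientMildSolution 1 v)
    (hm : ∀ t < 0, AEStronglyMeasurable (v t) volume)
    (hsm : ContDiffOn ℝ (⊤ : ℕ∞) (Function.uncurry v) (Set.Iio 0 ×ˢ Set.univ))
    (hun : ∀ t < 0, ∀ x, ⟪x - x₀, curl (v t) x⟫ = 0)
    (R : EuclideanSpace ℝ (Fin 3) ≃ₗᵢ[ℝ] EuclideanSpace ℝ (Fin 3))
    (hanti : ∀ t < 0, ∀ y, curl (v t) (x₀ + R y) =
      -((R : EuclideanSpace ℝ (Fin 3) →L[ℝ] EuclideanSpace ℝ (Fin 3)).det • R (curl (v t) (x₀ + y))))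
    (hcen : ∀ t < 0, R (v t x₀) = -v t x₀) :
    ∀ t < 0, ∃ b : EuclideanSpace ℝ (Fin 3), ∀ x, v t x = b :=
  constantOfIrrotational v hB hsm (curl_eq_zero_of_curl_antisymmetric_of_centre_reversed v x₀ hB hm hsm hun R hanti hcen)

end Summit.NavierStokesRegularity.NavierStokesRegularity.Theorems.PoloidalLiouville.Antidynamo

end
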